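import Summits.BirchSwinnertonDyer.BirchSwinnertonDyer.Theorems.ByReductionTypeAtTwoMultTowerNS2OrderCoboundary
import HarnessLib

/-!
# Route `ByReductionTypeAtTwo`, crux `MultUpperHalfAtTwo` (item stmt-BirchSwinnertonDyer-19922), TOWER road, NON-SPLIT rows:
# the ORDER of the local tower kernel at a non-split multiplicative `2`, part 2 — the count «among five `2^k`-torsion
# coinvariant classes of the twisted Tate module two coincide», every `k`

HONEST FRAMING (cell `bsd-2adic`, run/shared/lean/pub/bsd-2adic/, seat `bsd-2adic-tower-1` GEN 27, HUMAN RULINGS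
D-0036 / D-0054 / D-0074): TOOL theorems only (no definition, no named fact, no `sorry`); closes nothing by itself;
nothing booked; BSD is not proved by any of this. Second module of the KERNEL PROOF of the PRINT binder
`hNS2 = Greenberg1999.sec3_natCard_localTowerKerPrimary_le_four_nonsplitMultiplicative_two` (Greenberg, LNM 1716, §3
p. 93: `|ker(r_{v_n})| ∼ 2c_v ≤ 4` at a NON-SPLIT multiplicative `v ∣ 2`, every layer) — the ORDER bound itself, of which
GEN 10's `twoTorsion_localTowerKerPrimary_le_four_nonsplitTwo` is the `2`-torsion projection. This file is GEN 10's
`…MultTowerNS2TwoBitCount.lean` with the `2`-torsion data `x² = Q^j · gz/z` replaced by `2^k`-TORSION data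
`x^{2^k} = Q^j · gz/z`; the one non-formal input is C3 at exponent `2^k` (`exists_coboundary_of_pow_eq`, part 1).

Setting as in BRICKs 15/16 (`g` a topological generator of `H_n` modulo `H_∞` fixing `t`, `κ(res g) = 2^n u_g`; `τ₀ ∈ H_∞` a
flip; `Q` the Tate parameter; `T = {x ∈ K̄^{H_∞ ∩ Stab(t)} : τ₀x·x ∈ Q^ℤ}`, `B = Q^ℤ · (g−1)T`; `hN2` the class field input for
the unramified quadratic layer `K̄^{H_n ∩ Stab(t)}/F_n` in «three elements, two congruent» form, BRICK 17).

* `exists_div_eq_zpow_mul_coboundary_of_three_even_pow` — among three `x_i ∈ T` of EVEN exponent with `x_i^{2^k} ∈ B` two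
  are congruent modulo `B` (normalise to the unit circle, C3 at exponent `2^k`, `hN2` on the three `F_n`-rational norms,
  C7 `div_coboundary_eq_of_norm_rel`) — no case split, no Tate unit;
* `div_powTorsion_data` — bookkeeping: the quotient of two `2^k`-torsion data is a `2^k`-torsion datum with exponent `a − a'`;
* `exists_div_eq_zpow_mul_coboundary_of_five_pow` — among FIVE `2^k`-torsion elements two are congruent (three share an
  exponent parity; divide by one of them).
Consequence (part 3, `…MultTowerNS2OrderBound.lean`): `#(E(ℚ_{2,∞})/(g−1))[2^k] ≤ 4` for every `k`, whence
`#𝒦_{v,n}[2^∞] ≤ 4` by BRICK 11 and `2`-primary exhaustion — the named fact hNS2 PROVED.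

References: R. Greenberg, LNM 1716 (1999), §3 pp. 85–93; J. Silverman, GTM 151, V.3–V.5; J. Neukirch, *ANT* IV (3.5),
V (1.1); cell memos SCOPE-hNS2one-kernel-GEN8.md (S3–S6), NOTE-NS2-GALOIS-ACTION-GEN14.md (`#Q = 4` is sharp for
Tate unit `≡ ±1 (mod 8)`).
-/

set_option autoImplicit false
-- the Theorems namespace of this sub repeats the summit name by design (D-0017 nested layout: Summit.<S>.<Sub>)
set_option linter.dupNamespace false

noncomputable section

open scoped Classical IntermediateField

namespace Summit.BirchSwinnertonDyer.BirchSwinnertonDyer.Theorems.MultTowerNS2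

open NumberField IsDedekindDomain Field PadicInt Literature.NumberTheory.EllipticCurves
  Literature.NumberTheory.GaloisRepresentations

variable {κ : ZpExtension ℚ 2}

/-! ### Among three EVEN-exponent `2^k`-torsion elements two are congruent -/

/-- **No three pairwise incongruent `2^k`-torsion elements of EVEN exponent** (setting of BRICKs 15/16; `g` a topological
generator of `H_n` modulo `H_∞` fixing `t`; `τ₀ ∈ H_∞` a flip; `hN2` the class field input for the quadratic layer in «three
elements, two congruent» form; NO hypothesis on the Tate unit, NO case split): among any three `x₀, x₁, x₂ ∈ T` with
`τ₀x_i·x_i = Q^{2c_i}` and `x_i^{2^k} ∈ B = Q^ℤ·(g−1)T`, two are congruent modulo `B`. Normalise `x_i' = x_i Q^{-c_i}`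
(`smul_mul_zpow_inv_pow`), write `x_i' = gy_i/y_i` with `y_i·τ₀y_i ∈ F_nˣ` (C3 at exponent `2^k`,
`exists_coboundary_of_pow_eq`), apply `hN2` to the three norms, conclude by C7 (`div_coboundary_eq_of_norm_rel`).
[cite: GreenbergLNM1716, §3 (pp. 87–93)] [cite: NeukirchANT1999, Ch. V §1 Thm. (1.1)] -/
theorem exists_div_eq_zpow_mul_coboundary_of_three_even_pow (v : HeightOneSpectrum (𝓞 ℚ)) (n : ℕ)
    {g : absoluteGaloisGroup (v.adicCompletion ℚ)} {ug : ℤ_[2]ˣ}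
    (hug : ((κ (resGal (K := ℚ) (v.adicCompletion ℚ) g)).toAdd : ℤ_[2]) = 2 ^ n * (ug : ℤ_[2]))
    (hgn : g ∈ localSubgroup (κ.layerSubgroup n) (v.adicCompletion ℚ))
    {t : AlgebraicClosure (v.adicCompletion ℚ)}
    (ht : ∀ σ : absoluteGaloisGroup (v.adicCompletion ℚ), σ • t = t ∨ σ • t = -t) (hgt : g • t = t)
    {τ₀ : absoluteGaloisGroup (v.adicCompletion ℚ)} (hτ₀ : τ₀ ∈ localSubgroup κ.kerSubgroup (v.adicCompletion ℚ))
    (hτ₀t : τ₀ • t = -t) {Q : AlgebraicClosure (v.adicCompletion ℚ)}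
    (hQfix : ∀ σ : absoluteGaloisGroup (v.adicCompletion ℚ), σ • Q = Q) (hQ0 : Q ≠ 0)
    (hQtor : ∀ j : ℤ, Q ^ j = 1 → j = 0)
    (hN2 : ∀ c₁ c₂ c₃ : AlgebraicClosure (v.adicCompletion ℚ), c₁ ≠ 0 → c₂ ≠ 0 → c₃ ≠ 0 →
      (∀ h ∈ localSubgroup (κ.layerSubgroup n) (v.adicCompletion ℚ), h • c₁ = c₁) →
      (∀ h ∈ localSubgroup (κ.layerSubgroup n) (v.adicCompletion ℚ), h • c₂ = c₂) →
      (∀ h ∈ localSubgroup (κ.layerSubgroup n) (v.adicCompletion ℚ), h • c₃ = c₃) →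
      ∃ f₀ : AlgebraicClosure (v.adicCompletion ℚ), f₀ ≠ 0 ∧
        (∀ h ∈ localSubgroup (κ.layerSubgroup n) (v.adicCompletion ℚ), h • t = t → h • f₀ = f₀) ∧
        (c₁ = f₀ * τ₀ • f₀ * c₂ ∨ c₁ = f₀ * τ₀ • f₀ * c₃ ∨ c₂ = f₀ * τ₀ • f₀ * c₃))
    (k : ℕ) {x z : Fin 3 → AlgebraicClosure (v.adicCompletion ℚ)} {c j jz : Fin 3 → ℤ} (hx0 : ∀ i, x i ≠ 0)
    (hxL : ∀ i, ∀ h ∈ localSubgroup κ.kerSubgroup (v.adicCompletion ℚ), h • t = t → h • x i = x i)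
    (hxc : ∀ i, τ₀ • x i * x i = Q ^ (2 * c i)) (hz0 : ∀ i, z i ≠ 0)
    (hzL : ∀ i, ∀ h ∈ localSubgroup κ.kerSubgroup (v.adicCompletion ℚ), h • t = t → h • z i = z i)
    (hzj : ∀ i, τ₀ • z i * z i = Q ^ jz i) (hxk : ∀ i, x i ^ 2 ^ k = Q ^ j i * (g • z i / z i)) :
    ∃ i i' : Fin 3, i ≠ i' ∧ ∃ (c' : ℤ) (w : AlgebraicClosure (v.adicCompletion ℚ)), w ≠ 0 ∧
      (∀ h ∈ localSubgroup κ.kerSubgroup (v.adicCompletion ℚ), h • t = t → h • w = w) ∧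
      (∃ jw : ℤ, τ₀ • w * w = Q ^ jw) ∧ x i / x i' = Q ^ c' * (g • w / w) := by
  -- normalise and write each `x_i Q^{-c_i}` as a coboundary `g y_i / y_i` (C3 at exponent `2^k`)
  have hcob : ∀ i, ∃ y : AlgebraicClosure (v.adicCompletion ℚ), y ≠ 0 ∧
      (∀ h ∈ localSubgroup κ.kerSubgroup (v.adicCompletion ℚ), h • t = t → h • y = y) ∧
      x i * (Q ^ c i)⁻¹ = g • y / y ∧ y * τ₀ • y ≠ 0 ∧
      ∀ h ∈ localSubgroup (κ.layerSubgroup n) (v.adicCompletion ℚ), h • (y * τ₀ • y) = y * τ₀ • y := fun i ↦ by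
    obtain ⟨hx'L, hx'U, hx'k⟩ := smul_mul_zpow_inv_pow (κ := κ) v hQfix hQ0 (hxL i) (hxc i) (2 ^ k) (hxk i)
    exact exists_coboundary_of_pow_eq (κ := κ) v n hug ht hgt hτ₀ hτ₀t hQfix hQ0 hQtor hx'L hx'U k (hz0 i) (hzL i)
      (hzj i) hx'k
  choose y hy0 hyL hxy hN0 hNn using hcob
  -- the class field input on the three norms
  obtain ⟨f, hf0, hfM, hcases⟩ := hN2 (y 0 * τ₀ • y 0) (y 1 * τ₀ • y 1) (y 2 * τ₀ • y 2) (hN0 0) (hN0 1) (hN0 2)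
    (hNn 0) (hNn 1) (hNn 2)
  obtain ⟨i, i', hii', hrel⟩ : ∃ i i' : Fin 3, i ≠ i' ∧ y i * τ₀ • y i = f * τ₀ • f * (y i' * τ₀ • y i') := by
    rcases hcases with h | h | h
    exacts [⟨0, 1, by decide, h⟩, ⟨0, 2, by decide, h⟩, ⟨1, 2, by decide, h⟩]
  have hrel' : y i * τ₀ • y i = Q ^ (0 : ℤ) * (f * τ₀ • f) * (y i' * τ₀ • y i') := by
    rw [zpow_zero, one_mul]; exact hrel
  -- C7
  obtain ⟨hw0, hwL, hwε, hww⟩ :=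
    div_coboundary_eq_of_norm_rel (κ := κ) v n hgn hgt (hy0 i) (hy0 i') hf0 (hyL i) (hyL i') hfM hrel'
  refine ⟨i, i', hii', c i - c i', y i / (y i' * f), hw0, hwL, ⟨0, hwε⟩, ?_⟩
  have hQci : Q ^ c i ≠ 0 := zpow_ne_zero _ hQ0
  have hQci' : Q ^ c i' ≠ 0 := zpow_ne_zero _ hQ0
  have hxi' := hx0 i'
  rw [← hww, ← hxy i, ← hxy i', zpow_sub₀ hQ0]
  field_simp

/-! ### Among FIVE `2^k`-torsion elements two are congruent -/

/-- **Quotient of two `2^k`-torsion data.** If `x, x'` are `H_∞ ∩ Stab(t)`-invariant with `τ₀x·x = Q^a`, `τ₀x'·x' = Q^{a'}`,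
`x^{2^k} = Q^j·gz/z`, `x'^{2^k} = Q^{j'}·gz'/z'` (`z, z' ∈ T` with exponents `jz, jz'`), then `X = x/x'`, `Z = z/z'` satisfy the
same with exponents `a − a'`, `j − j'`, `jz − jz'`. [folklore] -/
theorem div_powTorsion_data (v : HeightOneSpectrum (𝓞 ℚ)) {g τ₀ : absoluteGaloisGroup (v.adicCompletion ℚ)}
    {t Q : AlgebraicClosure (v.adicCompletion ℚ)} (hQ0 : Q ≠ 0) (k : ℕ)
    {x x' z z' : AlgebraicClosure (v.adicCompletion ℚ)} {a a' j j' jz jz' : ℤ} (hx0 : x ≠ 0) (hx'0 : x' ≠ 0)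
    (hxL : ∀ h ∈ localSubgroup κ.kerSubgroup (v.adicCompletion ℚ), h • t = t → h • x = x)
    (hx'L : ∀ h ∈ localSubgroup κ.kerSubgroup (v.adicCompletion ℚ), h • t = t → h • x' = x')
    (hxa : τ₀ • x * x = Q ^ a) (hx'a : τ₀ • x' * x' = Q ^ a') (hz0 : z ≠ 0) (hz'0 : z' ≠ 0)
    (hzL : ∀ h ∈ localSubgroup κ.kerSubgroup (v.adicCompletion ℚ), h • t = t → h • z = z)
    (hz'L : ∀ h ∈ localSubgroup κ.kerSubgroup (v.adicCompletion ℚ), h • t = t → h • z' = z')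
    (hzj : τ₀ • z * z = Q ^ jz) (hz'j : τ₀ • z' * z' = Q ^ jz')
    (hxk : x ^ 2 ^ k = Q ^ j * (g • z / z)) (hx'k : x' ^ 2 ^ k = Q ^ j' * (g • z' / z')) :
    x / x' ≠ 0 ∧ (∀ h ∈ localSubgroup κ.kerSubgroup (v.adicCompletion ℚ), h • t = t → h • (x / x') = x / x') ∧
      τ₀ • (x / x') * (x / x') = Q ^ (a - a') ∧ z / z' ≠ 0 ∧
      (∀ h ∈ localSubgroup κ.kerSubgroup (v.adicCompletion ℚ), h • t = t → h • (z / z') = z / z') ∧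
      τ₀ • (z / z') * (z / z') = Q ^ (jz - jz') ∧ (x / x') ^ 2 ^ k = Q ^ (j - j') * (g • (z / z') / (z / z')) := by
  have hτx0 : τ₀ • x' ≠ 0 := (smul_ne_zero_iff_ne τ₀).mpr hx'0
  have hτz0 : τ₀ • z' ≠ 0 := (smul_ne_zero_iff_ne τ₀).mpr hz'0
  have hgz0 : g • z' ≠ 0 := (smul_ne_zero_iff_ne g).mpr hz'0
  have hτx1 : τ₀ • x' * x' ≠ 0 := by rw [hx'a]; exact zpow_ne_zero _ hQ0
  have hτz1 : τ₀ • z' * z' ≠ 0 := by rw [hz'j]; exact zpow_ne_zero _ hQ0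
  refine ⟨div_ne_zero hx0 hx'0, fun h hh hht ↦ by rw [smul_div₀', hxL h hh hht, hx'L h hh hht], ?_,
    div_ne_zero hz0 hz'0, fun h hh hht ↦ by rw [smul_div₀', hzL h hh hht, hz'L h hh hht], ?_, ?_⟩
  · rw [zpow_sub₀ hQ0, ← hxa, ← hx'a, smul_div₀']
    field_simp
  · rw [zpow_sub₀ hQ0, ← hzj, ← hz'j, smul_div₀']
    field_simp
  · rw [div_pow, hxk, hx'k, zpow_sub₀ hQ0, smul_div₀']
    field_simp

/-- **MAIN: no five pairwise incongruent `2^k`-torsion coinvariant classes.** In the setting of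
`exists_div_eq_zpow_mul_coboundary_of_three_even_pow`, among any five `x₀, …, x₄ ∈ T` whose `2^k`-th powers lie in
`B = q^ℤ·(g−1)T`, two are congruent modulo `B`: three of them have exponents `a_i` of the same parity (pigeonhole), and
dividing by one of these gives three EVEN-exponent data (`div_powTorsion_data`), to which the three-even lemma applies.
Hence the `2^k`-torsion of `E(ℚ_{2,∞})/(g−1)` has at most `4` elements for every `k` (assembly in part 3).
[cite: GreenbergLNM1716, §3 (pp. 87–93)] -/
theorem exists_div_eq_zpow_mul_coboundary_of_five_pow (v : HeightOneSpectrum (𝓞 ℚ)) (n : ℕ)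
    {g : absoluteGaloisGroup (v.adicCompletion ℚ)} {ug : ℤ_[2]ˣ}
    (hug : ((κ (resGal (K := ℚ) (v.adicCompletion ℚ) g)).toAdd : ℤ_[2]) = 2 ^ n * (ug : ℤ_[2]))
    (hgn : g ∈ localSubgroup (κ.layerSubgroup n) (v.adicCompletion ℚ))
    {t : AlgebraicClosure (v.adicCompletion ℚ)}
    (ht : ∀ σ : absoluteGaloisGroup (v.adicCompletion ℚ), σ • t = t ∨ σ • t = -t) (hgt : g • t = t)
    {τ₀ : absoluteGaloisGroup (v.adicCompletion ℚ)} (hτ₀ : τ₀ ∈ localSubgroup κ.kerSubgroup (v.adicCompletion ℚ))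
    (hτ₀t : τ₀ • t = -t) {Q : AlgebraicClosure (v.adicCompletion ℚ)}
    (hQfix : ∀ σ : absoluteGaloisGroup (v.adicCompletion ℚ), σ • Q = Q) (hQ0 : Q ≠ 0)
    (hQtor : ∀ j : ℤ, Q ^ j = 1 → j = 0)
    (hN2 : ∀ c₁ c₂ c₃ : AlgebraicClosure (v.adicCompletion ℚ), c₁ ≠ 0 → c₂ ≠ 0 → c₃ ≠ 0 →
      (∀ h ∈ localSubgroup (κ.layerSubgroup n) (v.adicCompletion ℚ), h • c₁ = c₁) →
      (∀ h ∈ localSubgroup (κ.layerSubgroup n) (v.adicCompletion ℚ), h • c₂ = c₂) →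
      (∀ h ∈ localSubgroup (κ.layerSubgroup n) (v.adicCompletion ℚ), h • c₃ = c₃) →
      ∃ f₀ : AlgebraicClosure (v.adicCompletion ℚ), f₀ ≠ 0 ∧
        (∀ h ∈ localSubgroup (κ.layerSubgroup n) (v.adicCompletion ℚ), h • t = t → h • f₀ = f₀) ∧
        (c₁ = f₀ * τ₀ • f₀ * c₂ ∨ c₁ = f₀ * τ₀ • f₀ * c₃ ∨ c₂ = f₀ * τ₀ • f₀ * c₃))
    (k : ℕ) {x z : Fin 5 → AlgebraicClosure (v.adicCompletion ℚ)} {a j jz : Fin 5 → ℤ} (hx0 : ∀ i, x i ≠ 0)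
    (hxL : ∀ i, ∀ h ∈ localSubgroup κ.kerSubgroup (v.adicCompletion ℚ), h • t = t → h • x i = x i)
    (hxa : ∀ i, τ₀ • x i * x i = Q ^ a i) (hz0 : ∀ i, z i ≠ 0)
    (hzL : ∀ i, ∀ h ∈ localSubgroup κ.kerSubgroup (v.adicCompletion ℚ), h • t = t → h • z i = z i)
    (hzj : ∀ i, τ₀ • z i * z i = Q ^ jz i) (hxk : ∀ i, x i ^ 2 ^ k = Q ^ j i * (g • z i / z i)) :
    ∃ i i' : Fin 5, i ≠ i' ∧ ∃ (c' : ℤ) (w : AlgebraicClosure (v.adicCompletion ℚ)), w ≠ 0 ∧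
      (∀ h ∈ localSubgroup κ.kerSubgroup (v.adicCompletion ℚ), h • t = t → h • w = w) ∧
      (∃ jw : ℤ, τ₀ • w * w = Q ^ jw) ∧ x i / x i' = Q ^ c' * (g • w / w) := by
  -- three indices with exponents of the same parity
  obtain ⟨b, hb⟩ := Fintype.exists_lt_card_fiber_of_mul_lt_card (fun i : Fin 5 ↦ decide (Even (a i)))
    (n := 2) (by simp)
  have hs3 : 3 ≤ Fintype.card {i : Fin 5 // decide (Even (a i)) = b} := by
    rw [Fintype.card_subtype]; exact hb
  let emb : Fin 3 ↪ {i : Fin 5 // decide (Even (a i)) = b} :=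
    (Fin.castLEEmb hs3).trans (Fintype.equivFin _).symm.toEmbedding
  let e : Fin 3 → Fin 5 := fun m ↦ (emb m : Fin 5)
  have he_inj : Function.Injective e := fun m m' h ↦ emb.injective (Subtype.ext h)
  have hpar : ∀ m : Fin 3, decide (Even (a (e m))) = b := fun m ↦ (emb m).2
  set i₀ : Fin 5 := e 0 with hi₀
  -- exponents `a (e m) - a i₀` are even
  have heven : ∀ m : Fin 3, ∃ c : ℤ, a (e m) - a i₀ = 2 * c := by
    intro m
    have h1 : Even (a (e m)) ↔ Even (a i₀) := decide_eq_decide.mp ((hpar m).trans (hpar 0).symm)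
    have h2 : Even (a (e m) - a i₀) := Int.even_sub.mpr h1
    obtain ⟨r, hr⟩ := h2
    exact ⟨r, by rw [hr]; ring⟩
  choose c hc using heven
  -- the quotient data `y m = x (e m) / x i₀`
  have hdata := fun m : Fin 3 ↦ div_powTorsion_data (κ := κ) v hQ0 k (hx0 (e m)) (hx0 i₀) (hxL (e m)) (hxL i₀)
    (hxa (e m)) (hxa i₀) (hz0 (e m)) (hz0 i₀) (hzL (e m)) (hzL i₀) (hzj (e m)) (hzj i₀) (hxk (e m)) (hxk i₀)
  have hyc : ∀ m : Fin 3, τ₀ • (x (e m) / x i₀) * (x (e m) / x i₀) = Q ^ (2 * c m) := fun m ↦ by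
    rw [← hc m]; exact (hdata m).2.2.1
  obtain ⟨m, m', hmm', c', w, hw0, hwL, hwj, hxw⟩ :=
    exists_div_eq_zpow_mul_coboundary_of_three_even_pow (κ := κ) v n hug hgn ht hgt hτ₀ hτ₀t hQfix hQ0 hQtor hN2 k
      (x := fun m ↦ x (e m) / x i₀) (z := fun m ↦ z (e m) / z i₀) (c := c) (j := fun m ↦ j (e m) - j i₀)
      (jz := fun m ↦ jz (e m) - jz i₀)
      (fun m ↦ (hdata m).1) (fun m ↦ (hdata m).2.1) hyc (fun m ↦ (hdata m).2.2.2.1) (fun m ↦ (hdata m).2.2.2.2.1)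
      (fun m ↦ (hdata m).2.2.2.2.2.1) (fun m ↦ (hdata m).2.2.2.2.2.2)
  refine ⟨e m, e m', fun h ↦ hmm' (he_inj h), c', w, hw0, hwL, hwj, ?_⟩
  have hxi₀ := hx0 i₀
  have hxm' := hx0 (e m')
  rw [← hxw]
  field_simp

end Summit.BirchSwinnertonDyer.BirchSwinnertonDyer.Theorems.MultTowerNS2

end
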